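import Summits.Schanuel.Schanuel.Theorems.RootDecomp1KHyper02

/-!
# RootDecomp1KHyper — part 3 of the «HyperCarving» port wave (lens 6, gen 9 = ROUND 4 of route-Schanuel-RootDecomp1K; 19 parts planned)

Mechanical port (census-1 gen 7, dependency closure; tools census/tools/gen7/portkit2.py + build_l6g9.py) of §17 of HOME/decomp-schanuel-lens-6/g9/HyperCarving.lean
(sha256 aba5c91f…, 8041 l; critic CLEARED FOR TYPING 2026-08-30T13:33:07Z; writer PATH A″ rev 5–8) together with the §§0–16 declarations it depends on
(nothing of the node was in the tree before except RootDecomp1KLinLiouvilleSplit and the Literature fact NesterenkoWaldschmidt1996_thm_5_1).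
This part: node lines 1453–2265 (26 declarations: sb_two_of_algebraicIndependent, mem_adjoin_SFset_I, sb_two_of_polyMeasure_liouville, CoordLiouvilleSpan, CoordLiouvilleSchanuel, StrictDiophantineSchanuel …).
All parts share the namespace `Summit.Schanuel.Schanuel.Theorems.RootDecomp1KHyper` (node sub-namespace `HyperCell` reproduced); statements and proofs
are the node's verbatim; `--supports stmt-Schanuel-33363` (A₄ʰ HyperLiouvilleSchanuel). Sorry-free; standard axioms. Nothing here proves Schanuel; rung 0.
-/

set_option linter.dupNamespace false
set_option linter.unusedSectionVars false

noncomputable section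

open Complex IntermediateField Filter Polynomial

namespace Summit.Schanuel.Schanuel.Theorems.RootDecomp1KHyper

variable {n K : ℕ}

/-- `trdeg_ℚ` is monotone along inclusions of subfields (Mathlib `trdeg_le_of_injective`). -/
private theorem trdeg_mono {F E : Type*} [Field F] [Field E] [Algebra F E] {L L' : IntermediateField F E}
    (h : L ≤ L') : Algebra.trdeg F L ≤ Algebra.trdeg F L' :=
  trdeg_le_of_injective (IntermediateField.inclusion h) (IntermediateField.inclusion_injective h)

/-- A field generated by a set `S` has transcendence degree `≤ #S` (copy of the tree's
`Literature.NumberTheory.Transcendental.trdeg_adjoin_le_mk`, module cone unbuilt tonight). -/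
private theorem trdeg_adjoin_le_mk {F E : Type*} [Field F] [Field E] [Algebra F E] (S : Set E) :
    Algebra.trdeg F ↥(adjoin F S) ≤ Cardinal.mk S := by
  haveI := Literature.NumberTheory.Transcendental.isAlgebraic_adjoin_over_algebraAdjoin (F := F) S
  exact (Algebra.IsAlgebraic.trdeg_le_cardinalMk F (((↑) : adjoin F S → E) ⁻¹' S)).trans
    (Cardinal.mk_preimage_of_injective _ _ Subtype.val_injective)

set_option synthInstance.maxHeartbeats 400000 in
/-- **Subadditivity** `trdeg_K K(S ∪ T) ≤ trdeg_K K(S) + trdeg_K K(T)` (copy of the tree's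
`Literature.NumberTheory.Transcendental.trdeg_adjoin_union_le`, module cone unbuilt tonight). -/
private theorem trdeg_adjoin_union_le {K E : Type*} [Field K] [Field E] [Algebra K E] (S T : Set E) :
    Algebra.trdeg K ↥(adjoin K (S ∪ T)) ≤
      Algebra.trdeg K ↥(adjoin K S) + Algebra.trdeg K ↥(adjoin K T) := by
  have htower := trdeg_add_eq K (adjoin K S) (A := adjoin (adjoin K S) T)
  have heq : Algebra.trdeg K (adjoin (adjoin K S) T) = Algebra.trdeg K (adjoin K (S ∪ T)) := by
    rw [← (equivOfEq (adjoin_adjoin_left K S T)).trdeg_eq]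
    rfl
  have hbc := Literature.NumberTheory.Transcendental.trdeg_adjoin_le_of_le (K := K) (E := E)
    (F₁ := adjoin K (∅ : Set E)) (F₂ := adjoin K S) (adjoin.mono K _ _ (Set.empty_subset S)) T
  have htower0 := trdeg_add_eq K (adjoin K (∅ : Set E)) (A := adjoin (adjoin K (∅ : Set E)) T)
  have heq0 : Algebra.trdeg K (adjoin (adjoin K (∅ : Set E)) T) = Algebra.trdeg K (adjoin K T) := by
    have h1 : Algebra.trdeg K ↥(adjoin K T) = Algebra.trdeg K ↥(adjoin K (∅ ∪ T)) := by
      rw [Set.empty_union]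
    rw [h1, ← (equivOfEq (adjoin_adjoin_left K ∅ T)).trdeg_eq]
    rfl
  have hzero : Algebra.trdeg K ↥(adjoin K (∅ : Set E)) = 0 :=
    nonpos_iff_eq_zero.mp ((trdeg_adjoin_le_mk (F := K) (∅ : Set E)).trans (by simp))
  rw [hzero, zero_add, heq0] at htower0
  rw [heq] at htower
  rw [← htower, ← htower0]
  gcongr

/-- `k` algebraically independent numbers generate a field of transcendence degree `≥ k`. -/
private theorem le_trdeg_adjoin_of_algebraicIndependent {ι : Type} [Fintype ι] {y : ι → ℂ}
    (h : AlgebraicIndependent ℚ y) :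
    (Fintype.card ι : Cardinal) ≤ Algebra.trdeg ℚ ↥(adjoin ℚ (Set.range y)) := by
  let f : ι → adjoin ℚ (Set.range y) := fun i => ⟨y i, subset_adjoin ℚ _ ⟨i, rfl⟩⟩
  have hf : AlgebraicIndependent ℚ f := AlgebraicIndependent.of_comp (adjoin ℚ (Set.range y)).val h
  simpa using hf.cardinalMk_le_trdeg

/-- §3. Tools: Liouville numbers are transcendental; a Liouville real outside any finite span: auxiliary statement `isAlgebraic_I` (lens 6 gen 9 node, ported verbatim). -/
private theorem isAlgebraic_I : IsAlgebraic ℚ Complex.I := by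
  refine ⟨X ^ 2 + 1, ?_, ?_⟩
  · exact (Polynomial.monic_X_pow_add_C (1 : ℚ) two_ne_zero).ne_zero
  · simp [Complex.I_sq]

/-- If the Schanuel field `ℚ(z, e^z, i)` of a pair `z` (harmlessly enlarged by `i`, which costs no
transcendence degree) contains two algebraically independent numbers, then `SB 2 z`. -/
theorem sb_two_of_algebraicIndependent {a b : ℂ} (hai : AlgebraicIndependent ℚ ![a, b])
    {z : Fin 2 → ℂ} (ha : a ∈ adjoin ℚ (SFset z ∪ {I})) (hb : b ∈ adjoin ℚ (SFset z ∪ {I})) :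
    SB 2 z := by
  have h2 := le_trdeg_adjoin_of_algebraicIndependent hai
  simp only [Fintype.card_fin] at h2
  have hsub : Set.range ![a, b] ⊆ (adjoin ℚ (SFset z ∪ {I}) : Set ℂ) := by
    rintro x ⟨i, rfl⟩
    fin_cases i
    · exact ha
    · exact hb
  have hle : adjoin ℚ (Set.range ![a, b]) ≤ adjoin ℚ (SFset z ∪ {I}) := adjoin_le_iff.mpr hsub
  have h3 := h2.trans (trdeg_mono hle)
  have h4 := trdeg_adjoin_union_le (K := ℚ) (SFset z) ({I} : Set ℂ)
  rw [trdeg_adjoin_singleton_eq_zero isAlgebraic_I.isIntegral, add_zero] at h4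
  exact h3.trans h4

/-- §7c. From an independent pair to Schanuel's bound at a 2-tuple: auxiliary statement `mem_adjoin_SFset_I` (lens 6 gen 9 node, ported verbatim). -/
theorem mem_adjoin_SFset_I {z : Fin 2 → ℂ} {x : ℂ} (hx : x ∈ SFset z) :
    x ∈ adjoin ℚ (SFset z ∪ {I}) :=
  subset_adjoin ℚ _ (Or.inl hx)

/-- **MASTER CELL (axis form).** `PolyMeasure θ`, `ℓ` Liouville, and `θ, ℓ ∈ ℚ(z, e^z, i)`
give Schanuel's bound at the pair `z`. -/
theorem sb_two_of_polyMeasure_liouville {θ : ℂ} (hθ : PolyMeasure θ) {ℓ : ℝ} (hℓ : Liouville ℓ)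
    {z : Fin 2 → ℂ} (hθz : θ ∈ adjoin ℚ (SFset z ∪ {I})) (hℓz : (ℓ : ℂ) ∈ adjoin ℚ (SFset z ∪ {I})) :
    SB 2 z :=
  sb_two_of_algebraicIndependent (algebraicIndependent_of_polyMeasure_liouville hθ hℓ) hθz hℓz

/-- **Round-2 cut predicate**: the ℚ-span of `z` contains a number with a Liouville real part or
a Liouville imaginary part.  Span-intrinsic; implied by `LiouvilleSpan z`. -/
def CoordLiouvilleSpan {n : ℕ} (z : Fin n → ℂ) : Prop :=
  ∃ w ∈ Submodule.span ℚ (Set.range z), Liouville w.re ∨ Liouville w.im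

/-- **Piece S_L′ — `CoordLiouvilleSchanuel`** (crux, round 2): Schanuel's bound for the ℚ-free
tuples whose span contains a number with a Liouville coordinate.  Implies `LiouvilleSchanuel`
(hence `DefectOneSchanuel`); level 1 and the level-2 storey «real measured number × Liouville
coordinate» are theorems below. -/
def CoordLiouvilleSchanuel : Prop :=
  ∀ (n : ℕ) (z : Fin n → ℂ), LinearIndependent ℚ z →
    (∃ w ∈ Submodule.span ℚ (Set.range z), Liouville w.re ∨ Liouville w.im) →
    (n : Cardinal) ≤ Algebra.trdeg ℚ ↥(IntermediateField.adjoin ℚ (Set.range z ∪ Set.range (Complex.exp ∘ z)))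

/-- **Piece S_D′ — `StrictDiophantineSchanuel`** (crux, declared residual, round 2): Schanuel's
bound for the ℚ-free tuples NO element of whose span has a Liouville coordinate.  Implied by
`DiophantineSchanuel` (smaller scope); still contains every flagship tuple (§9d). -/
def StrictDiophantineSchanuel : Prop :=
  ∀ (n : ℕ) (z : Fin n → ℂ), LinearIndependent ℚ z →
    (¬ ∃ w ∈ Submodule.span ℚ (Set.range z), Liouville w.re ∨ Liouville w.im) →
    (n : Cardinal) ≤ Algebra.trdeg ℚ ↥(IntermediateField.adjoin ℚ (Set.range z ∪ Set.range (Complex.exp ∘ z)))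

/-- **Deciding theorem, round 2.** `S_L′ → S_D′ → Schanuel`. -/
theorem closes₂ (hL : CoordLiouvilleSchanuel) (hD : StrictDiophantineSchanuel) : _root_.Schanuel := by
  intro n z hz
  by_cases h : ∃ w ∈ Submodule.span ℚ (Set.range z), Liouville w.re ∨ Liouville w.im
  · exact hL n z hz h
  · exact hD n z hz h

/-- §9a. Deciding theorem, exactness, the lattice of pieces: auxiliary statement `coordLiouvilleSchanuel_of_schanuel` (lens 6 gen 9 node, ported verbatim). -/
theorem coordLiouvilleSchanuel_of_schanuel (h : _root_.Schanuel) : CoordLiouvilleSchanuel :=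
  fun n z hz _ => h n z hz

/-- §9a. Deciding theorem, exactness, the lattice of pieces: auxiliary statement `strictDiophantineSchanuel_of_schanuel` (lens 6 gen 9 node, ported verbatim). -/
theorem strictDiophantineSchanuel_of_schanuel (h : _root_.Schanuel) : StrictDiophantineSchanuel :=
  fun n z hz _ => h n z hz

/-- Verbatim copy of the Literature named fact
`Literature.NumberTheory.Transcendental.NesterenkoWaldschmidt1996_thm_2_2` (Nesterenko–Waldschmidt
1996, Theorem 2 (2): `|P(π)| ≥ exp(−2·10⁶ d (log L + d log d)(1 + log d))` for `P ∈ ℤ[X]∖0` of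
degree `≤ d` and length `≤ L`, `L ≥ 3`), PROVED in the tree (`NesterenkoWaldschmidt1996_thm_2_2_holds`,
`PiTranscendenceMeasureMain.lean`, imported above): `piNWMeasure_iff_tree` certifies the copy is
literal (`Iff.rfl`) and `piNWMeasure_holds` DISCHARGES it — every `π`-statement of this section is
hypothesis-free. -/
def PiNWMeasure : Prop :=
  ∀ (P : Polynomial ℤ) (d L : ℕ), P ≠ 0 → 1 ≤ d → P.natDegree ≤ d →
    (∑ k ∈ Finset.range (P.natDegree + 1), |P.coeff k|) ≤ (L : ℤ) → 3 ≤ L →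
    Real.exp (-(2 * 10 ^ 6 * (d : ℝ) * (Real.log L + d * Real.log d) * (1 + Real.log d))) ≤
      ‖Polynomial.aeval (Real.pi : ℂ) P‖

/-- The tree's proof of the Nesterenko–Waldschmidt measure for `π`. -/
theorem piNWMeasure_holds : PiNWMeasure :=
  Literature.NumberTheory.Transcendental.NesterenkoWaldschmidt1996_thm_2_2_holds

/-- `π` has a `PolyMeasure` (mod `hπ`): at fixed `d` the shape is `A log L + B`,
`A = 2·10⁶ d (1 + log d)`, `B = A · d log d`. -/
theorem polyMeasure_pi_of_NW (hπ : PiNWMeasure) : PolyMeasure (Real.pi : ℂ) := by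
  refine polyMeasure_of_lenMeasure fun d => ?_
  have hD1 : (1 : ℝ) ≤ ((d + 1 : ℕ) : ℝ) := by exact_mod_cast Nat.le_add_left 1 d
  have hlogD : 0 ≤ Real.log ((d + 1 : ℕ) : ℝ) := Real.log_nonneg hD1
  refine ⟨2 * 10 ^ 6 * ((d + 1 : ℕ) : ℝ) * (1 + Real.log ((d + 1 : ℕ) : ℝ)),
    2 * 10 ^ 6 * ((d + 1 : ℕ) : ℝ) * (1 + Real.log ((d + 1 : ℕ) : ℝ)) *
      (((d + 1 : ℕ) : ℝ) * Real.log ((d + 1 : ℕ) : ℝ)),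
    mul_nonneg (by positivity) (by linarith), fun P H hP hdeg hH hlen => ?_⟩
  have h := hπ P (d + 1) H hP (by omega) (hdeg.trans (by omega))
    (by unfold len at hlen; exact hlen) (by omega)
  have e : 2 * 10 ^ 6 * ((d + 1 : ℕ) : ℝ) * (1 + Real.log ((d + 1 : ℕ) : ℝ)) * Real.log H +
      2 * 10 ^ 6 * ((d + 1 : ℕ) : ℝ) * (1 + Real.log ((d + 1 : ℕ) : ℝ)) *
        (((d + 1 : ℕ) : ℝ) * Real.log ((d + 1 : ℕ) : ℝ)) =
      2 * 10 ^ 6 * ((d + 1 : ℕ) : ℝ) * (Real.log H + ((d + 1 : ℕ) : ℝ) * Real.log ((d + 1 : ℕ) : ℝ)) *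
        (1 + Real.log ((d + 1 : ℕ) : ℝ)) := by ring
  rw [e]; exact h

/-- **`π` has a polynomial transcendence measure in every degree — unconditionally in this file.** -/
theorem polyMeasure_pi : PolyMeasure (Real.pi : ℂ) := polyMeasure_pi_of_NW piNWMeasure_holds

/-- Length of an integer polynomial in several variables: `Σ_m |coeff_m P|`. -/
def mvlen (P : MvPolynomial (Fin n) ℤ) : ℤ := ∑ m ∈ P.support, |P.coeff m|

/-- §10b. Several variables: lengths, MvPolyMeasure, clearing denominators: auxiliary statement `mvlen_nonneg` (lens 6 gen 9 node, ported verbatim). -/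
theorem mvlen_nonneg (P : MvPolynomial (Fin n) ℤ) : 0 ≤ mvlen P :=
  Finset.sum_nonneg fun _ _ => abs_nonneg _

/-- §10b. Several variables: lengths, MvPolyMeasure, clearing denominators: auxiliary statement `mvlen_eq_sum_of_support_subset` (lens 6 gen 9 node, ported verbatim). -/
theorem mvlen_eq_sum_of_support_subset (P : MvPolynomial (Fin n) ℤ) {s : Finset (Fin n →₀ ℕ)}
    (hs : P.support ⊆ s) : mvlen P = ∑ m ∈ s, |P.coeff m| := by
  unfold mvlen
  refine Finset.sum_subset hs fun m _ hm => ?_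
  have : P.coeff m = 0 := by simpa [MvPolynomial.mem_support_iff] using hm
  rw [this, abs_zero]

/-- §10b. Several variables: lengths, MvPolyMeasure, clearing denominators: auxiliary statement `abs_coeff_le_mvlen` (lens 6 gen 9 node, ported verbatim). -/
theorem abs_coeff_le_mvlen (P : MvPolynomial (Fin n) ℤ) (m : Fin n →₀ ℕ) :
    |P.coeff m| ≤ mvlen P := by
  by_cases hm : m ∈ P.support
  · exact Finset.single_le_sum (f := fun m => |P.coeff m|) (fun _ _ => abs_nonneg _) hm
  · have : P.coeff m = 0 := by simpa [MvPolynomial.mem_support_iff] using hm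
    rw [this, abs_zero]; exact mvlen_nonneg P

/-- §10b. Several variables: lengths, MvPolyMeasure, clearing denominators: auxiliary statement `one_le_mvlen` (lens 6 gen 9 node, ported verbatim). -/
theorem one_le_mvlen {P : MvPolynomial (Fin n) ℤ} (hP : P ≠ 0) : 1 ≤ mvlen P := by
  obtain ⟨m, hm⟩ := MvPolynomial.ne_zero_iff.mp hP
  calc (1 : ℤ) ≤ |P.coeff m| := Int.one_le_abs hm
    _ ≤ mvlen P := abs_coeff_le_mvlen P m

/-- **`MvPolyMeasure θ`** — the tuple `θ = (θ₁, …, θₙ)` has, in every total degree `d`, a measure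
of algebraic independence polynomial in the length: `1 ≤ C · mvlen(P)^τ · |P(θ)|` for all
non-zero `P ∈ ℤ[X₁, …, Xₙ]` of total degree `≤ d` (the several-variables class S ∪ T). -/
def MvPolyMeasure (θ : Fin n → ℂ) : Prop :=
  ∀ d : ℕ, ∃ (C : ℝ) (τ : ℕ), 0 < C ∧ ∀ P : MvPolynomial (Fin n) ℤ, P ≠ 0 → P.totalDegree ≤ d →
    1 ≤ C * ((mvlen P : ℤ) : ℝ) ^ τ * ‖MvPolynomial.aeval θ P‖

/-- Clearing denominators: every `g ∈ ℚ[X₁, …, Xₙ]` has a non-zero integer multiple with integer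
coefficients. -/
theorem exists_int_mul_eq_map (g : MvPolynomial (Fin n) ℚ) :
    ∃ (N : ℤ) (G : MvPolynomial (Fin n) ℤ), N ≠ 0 ∧
      MvPolynomial.map (Int.castRingHom ℚ) G = MvPolynomial.C (N : ℚ) * g := by
  classical
  set N : ℕ := ∏ m ∈ g.support, (g.coeff m).den with hN
  have hN0 : N ≠ 0 := Finset.prod_ne_zero_iff.mpr fun m _ => (g.coeff m).den_nz
  have hint : ∀ m ∈ g.support, ∃ z : ℤ, (z : ℚ) = (N : ℚ) * g.coeff m := by
    intro m hm
    refine ⟨(∏ m' ∈ g.support.erase m, ((g.coeff m').den : ℤ)) * (g.coeff m).num, ?_⟩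
    have h1 : (N : ℚ) = (∏ m' ∈ g.support.erase m, ((g.coeff m').den : ℚ)) * (g.coeff m).den := by
      rw [hN, ← Finset.prod_erase_mul _ _ hm]; push_cast; ring
    have h2 : ((g.coeff m).den : ℚ) * g.coeff m = (g.coeff m).num := by
      rw [mul_comm]; exact Rat.mul_den_eq_num _
    rw [h1, mul_assoc, h2]; push_cast; ring
  choose! z hz using hint
  refine ⟨N, ∑ m ∈ g.support, MvPolynomial.monomial m (z m), by exact_mod_cast hN0, ?_⟩
  rw [map_sum]
  simp only [MvPolynomial.map_monomial]
  conv_rhs => rw [← g.support_sum_monomial_coeff, Finset.mul_sum]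
  refine Finset.sum_congr rfl fun m hm => ?_
  rw [eq_intCast, hz m hm, Int.cast_natCast, MvPolynomial.C_mul_monomial]

/-- Integer polynomials evaluate the same through `ℤ[X] → ℚ[X]`. -/
theorem mvaeval_int_map (θ : Fin n → ℂ) (G : MvPolynomial (Fin n) ℤ) :
    MvPolynomial.aeval θ (MvPolynomial.map (Int.castRingHom ℚ) G) = MvPolynomial.aeval θ G := by
  rw [show Int.castRingHom ℚ = algebraMap ℤ ℚ from rfl, MvPolynomial.aeval_map_algebraMap]

/-- Specialisation `Σ_k p^k q^{K−k} G_k ∈ ℤ[X₁, …, Xₙ]` (`= q^K P(X, p/q)`). -/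
def mvspecialise {K : ℕ} (G : Fin (K + 1) → MvPolynomial (Fin n) ℤ) (p : ℤ) (q : ℕ) :
    MvPolynomial (Fin n) ℤ :=
  ∑ k : Fin (K + 1), MvPolynomial.C (p ^ (k : ℕ) * (q : ℤ) ^ (K - k)) * G k

/-- §10c. The extraction in several variables: auxiliary statement `mvaeval_mvspecialise` (lens 6 gen 9 node, ported verbatim). -/
theorem mvaeval_mvspecialise {K : ℕ} (G : Fin (K + 1) → MvPolynomial (Fin n) ℤ) (p : ℤ) {q : ℕ}
    (hq : q ≠ 0) (θ : Fin n → ℂ) :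
    MvPolynomial.aeval θ (mvspecialise G p q) =
      (q : ℂ) ^ K * ∑ k : Fin (K + 1), MvPolynomial.aeval θ (G k) * ((p : ℂ) / q) ^ (k : ℕ) := by
  unfold mvspecialise
  rw [map_sum, Finset.mul_sum]
  refine Finset.sum_congr rfl fun k _ => ?_
  have hk : (k : ℕ) ≤ K := Nat.lt_succ_iff.mp k.2
  have hqC : (q : ℂ) ≠ 0 := by exact_mod_cast hq
  have hsplit : (q : ℂ) ^ K = (q : ℂ) ^ (k : ℕ) * (q : ℂ) ^ (K - k) := by
    rw [← pow_add, Nat.add_sub_cancel' hk]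
  rw [map_mul, MvPolynomial.aeval_C, algebraMap_int_eq, eq_intCast]
  push_cast
  rw [hsplit, div_pow]
  field_simp

/-- §10c. The extraction in several variables: auxiliary statement `totalDegree_mvspecialise_le` (lens 6 gen 9 node, ported verbatim). -/
theorem totalDegree_mvspecialise_le {K : ℕ} (G : Fin (K + 1) → MvPolynomial (Fin n) ℤ) (p : ℤ)
    (q : ℕ) {D : ℕ} (hD : ∀ k, (G k).totalDegree ≤ D) : (mvspecialise G p q).totalDegree ≤ D := by
  unfold mvspecialise
  refine (MvPolynomial.totalDegree_finsetSum _ _).trans (Finset.sup_le fun k _ => ?_)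
  refine (MvPolynomial.totalDegree_mul _ _).trans ?_
  rw [MvPolynomial.totalDegree_C, zero_add]
  exact hD k

/-- §10c. The extraction in several variables: auxiliary statement `coeff_mvspecialise` (lens 6 gen 9 node, ported verbatim). -/
theorem coeff_mvspecialise {K : ℕ} (G : Fin (K + 1) → MvPolynomial (Fin n) ℤ) (p : ℤ) (q : ℕ)
    (m : Fin n →₀ ℕ) : (mvspecialise G p q).coeff m =
      ∑ k : Fin (K + 1), (p ^ (k : ℕ) * (q : ℤ) ^ (K - k)) * (G k).coeff m := by
  unfold mvspecialise
  rw [MvPolynomial.coeff_sum]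
  simp only [MvPolynomial.coeff_C_mul]

/-- §10c. The extraction in several variables: auxiliary statement `mvlen_mvspecialise_le` (lens 6 gen 9 node, ported verbatim). -/
theorem mvlen_mvspecialise_le {K : ℕ} (G : Fin (K + 1) → MvPolynomial (Fin n) ℤ) (p : ℤ) (q : ℕ) :
    mvlen (mvspecialise G p q) ≤ (|p| + q) ^ K * ∑ k : Fin (K + 1), mvlen (G k) := by
  classical
  set s : Finset (Fin n →₀ ℕ) := Finset.univ.biUnion fun k : Fin (K + 1) => (G k).support with hs
  have hGs : ∀ k, (G k).support ⊆ s := fun k =>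
    Finset.subset_biUnion_of_mem (fun k : Fin (K + 1) => (G k).support) (Finset.mem_univ k)
  have hSs : (mvspecialise G p q).support ⊆ s := by
    intro m hm
    rw [MvPolynomial.mem_support_iff, coeff_mvspecialise] at hm
    by_contra hms
    apply hm
    refine Finset.sum_eq_zero fun k _ => ?_
    have hmk : m ∉ (G k).support := fun h => hms (hGs k h)
    have : (G k).coeff m = 0 := by simpa [MvPolynomial.mem_support_iff] using hmk
    rw [this, mul_zero]
  have hpow : ∀ k : Fin (K + 1), |p ^ (k : ℕ) * (q : ℤ) ^ (K - k)| ≤ (|p| + q) ^ K := by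
    intro k
    have hk : (k : ℕ) ≤ K := Nat.lt_succ_iff.mp k.2
    rw [abs_mul, abs_pow, abs_pow, Nat.abs_cast]
    calc |p| ^ (k : ℕ) * (q : ℤ) ^ (K - k) ≤ (|p| + q) ^ (k : ℕ) * (|p| + q) ^ (K - k) := by
          gcongr
          · exact le_add_of_nonneg_right (by positivity)
          · exact le_add_of_nonneg_left (abs_nonneg p)
      _ = (|p| + q) ^ K := by rw [← pow_add, Nat.add_sub_cancel' hk]
  rw [mvlen_eq_sum_of_support_subset _ hSs]
  calc ∑ m ∈ s, |(mvspecialise G p q).coeff m|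
      ≤ ∑ m ∈ s, ∑ k : Fin (K + 1), (|p| + q) ^ K * |(G k).coeff m| := by
        refine Finset.sum_le_sum fun m _ => ?_
        rw [coeff_mvspecialise]
        refine (Finset.abs_sum_le_sum_abs _ _).trans (Finset.sum_le_sum fun k _ => ?_)
        rw [abs_mul]
        exact mul_le_mul_of_nonneg_right (hpow k) (abs_nonneg _)
    _ = (|p| + q) ^ K * ∑ k : Fin (K + 1), ∑ m ∈ s, |(G k).coeff m| := by
        rw [Finset.sum_comm, Finset.mul_sum]
        refine Finset.sum_congr rfl fun k _ => ?_
        rw [Finset.mul_sum]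
    _ = (|p| + q) ^ K * ∑ k : Fin (K + 1), mvlen (G k) := by
        congr 1
        refine Finset.sum_congr rfl fun k _ => ?_
        rw [mvlen_eq_sum_of_support_subset _ (hGs k)]

end Summit.Schanuel.Schanuel.Theorems.RootDecomp1KHyper
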